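import Summits.CriticalPhenomena.PercolationContinuityZ3.Theorems.Transplant.SkelNegBChoiceAllS
import Summits.CriticalPhenomena.PercolationContinuityZ3.Theorems.Transplant.SkelPhiCellsSmallM
import HarnessLib

/-!
# N1 params, chain of record `NegB`, part ChoiceAllT: THE CHOICE FUNCTION OF RECORD WITH THE RE-RULED ARRIVAL BOX `b0T := r/4` (10 strides; p5-g9 2026-08-21T18:30:46Z located ask (L2): the y′-band's transverse slop needs > 3 strides of room; supersedes part ChoiceAllS's `b0 := r/8`) — the box half-widths
# `NegB.b0T κ Φ t p D g f : Fin 2 → ℕ := fun i => fcells.r i / 4` (= 10 strides; hp-8's `PCells2.Mb`), the scheme of record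
# `NegB.ΓOT := cellGeomSG₂b G fineO fcells t (schedOf …) b0T` (hp-8's defeq twin p292701 — every field but `M` is `cellGeomSG₂`'s), `choiceAtOT`,
# **`negChoiceAllOT gv fv Pv Sv : ChoiceFnNO`**, the `AtQO` unpacking (verbatim: `AtQO` does not read the scheme), and **`geomHoldsNOFn_negChoiceAllOT`** for every slot value, and the transfer **`atQOS_of_atQOT`** (so every landed `…_of_atQOT` / `KS.…_R` lemma applies)

builds on p205010 (kernel theorem, internal audit signed; external expert review pending) — nothing in this file uses p205010; NOTHING is claimed about
the node `SamePDropOfSkeletonNeg₁` (OPEN).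
Status sentence (coordinator 2026-08-20T04:30Z): "θ(p_c) = 0 on ℤ^d, all d ≥ 2 — kernel-verified (Lean 4/Mathlib, standard axioms); internal adversarial
audit SIGNED 2026-08-20 04:29Z; external expert review pending."
Lane `prim-bschramm-*`, seat `prim-bschramm-stmt` (gen 14); helper file (`--supports stmt-CriticalPhenomena-4575 --as helper`); ledger HOME/prim-bschramm-stmt/NEG-PARAMS.md v0.11.
Supersedes `negChoiceAllOB` (SkelNegBChoiceAll p288339, the `cen ± 3r` boxes: p5-g9's located finding C-STEP0 — no window map over the fat box) as THE choice function the node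
file instantiates; `negChoiceAllOB` stays as the fat-box reading.  HOW TO STATE A RESIDUE THEOREM: exactly as in SkelNegBChoiceAll's docstring with `OB ↦ OS`; the scheme is
`NegB.ΓOT κ Φ t p O gv fv Sv q`, whose `M a v = VWin G fineO t (fcells.Mb b0T v) (schedOf….rM a v)` (`cellGeomSG₂b_M`, `PCells2.mem_Mb_iff`) and whose other fields are
`cellGeomSG₂`'s (`cellGeomSG₂b_Q/_Cell/_Btw/_Efar/_Stub/_Zone/_Ewv/_col/_root/_a₀/_K/_anchor/_anchSet`, all `rfl`/`simp`); every `…_of_atQOB` fact transfers by `atQOB_of_atQOT`.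
* §1 `b0T` (+ `b0T_eq : b0T i = 10·Kq·s i`, `b0T_le : ≤ 3·r i`, `b0T_ge : 8·Kq·s i ≤ b0T i ∧ 1 ≤ b0T i`, `b0T_le_two : ≤ 2·r i ∧ r i ≤ 4·b0T i + 3`, `b0T_eq_div : = r i / 4`), `ΓOT/FDOT`, `choiceAtOT`, **`negChoiceAllOT`** (+ `_eq`);
* §2 `atQOB_of_atQOT`/`atQOT_of_atQOB` (componentwise — the kernel must never compare the two schemes), `factsO/eqNumL/clauseL/clauseS/clauseP/inputsP/inputsExtra/inputsS/inputsL/zone/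
  _of_atQOT`, **`atQOS_of_atQOT`**;
* §3 **`geomHoldsNOFn_negChoiceAllOT`** (via part ChoiceAllS's `geom_fine_at_b`, generic in `b₀`).
[cite: KozmaNitzan2024, §4 Theorem 6 (pp. 25–31); pp. 25–29] [cite: MartineauTassion2017, §3.2 Lemma 3.5, §4.3]
-/

noncomputable section

open scoped Classical

namespace Summit.CriticalPhenomena.PercolationContinuityZ3.Theorems.Transplant

open MeasureTheory Literature.Probability.Percolation Literature.Probability.LatticeModels SimpleGraph KNCells
open Literature.Barriers.CriticalPhenomena (HasExponentialGrowth)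

namespace PlanarSkeletonNeg

open SkelConc (Consts)
open BoxProdZ2 (ConcRadiiG)
open Skelφ (oriφ trφ)
open Skelφ.StepI (DataN OutO)

namespace NegB

open Neg

/-! ## §1 The small box, the scheme of record, the choice function -/

section Values

variable (κ : Consts) {V : Type} [DecidableEq V] [Countable V] {G : SimpleGraph V} [G.LocallyFinite] (Φ : PlanarSkeletonNeg G) (t : V)
  (p : unitInterval) (D : DataN V) (g f : ℕ)

/-- **THE ARRIVAL-BOX HALF-WIDTHS OF RECORD, RE-RULED** (10 strides per axis, in fine cells): `b0T i := fcells.r i / 4` (`= 10·Kq·s_i`, one stride = `Kq·s_i` fine cells).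
[this work] -/
def b0T : Fin 2 → ℕ := fun i => (fcells κ Φ t p D g f).r i / 4

/-- `b0T i = r i / 4` (by `rfl`). [folklore] -/
theorem b0T_eq_div (i : Fin 2) : b0T κ Φ t p D g f i = (fcells κ Φ t p D g f).r i / 4 := rfl

/-- **`b0T i = 10·Kq·s_i`** (`K = 40·Kq`, `r i = K·s i`): ten strides. [folklore] -/
theorem b0T_eq (i : Fin 2) : b0T κ Φ t p D g f i = 10 * Neg.Kq κ * (fcells κ Φ t p D g f).s i := by
  have hr := (fcells_K κ Φ t p D g f).2.2 i
  rw [b0T_eq_div, hr, Neg.K_eq]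
  have : 40 * Neg.Kq κ * (fcells κ Φ t p D g f).s i = 4 * (10 * Neg.Kq κ * (fcells κ Φ t p D g f).s i) := by ring
  rw [this, Nat.mul_div_cancel_left _ (by norm_num)]

/-- **`b0T i ≤ 3·r i`** (hp-8's `hb`). [folklore] -/
theorem b0T_le (i : Fin 2) : b0T κ Φ t p D g f i ≤ 3 * (fcells κ Φ t p D g f).r i := by
  rw [b0T_eq_div]; omega

/-- `8 strides ≤ b0T i` in the form `8·Kq·s i ≤ b0T i` and `1 ≤ b0T i`. [folklore] -/
theorem b0T_ge (i : Fin 2) : 8 * Neg.Kq κ * (fcells κ Φ t p D g f).s i ≤ b0T κ Φ t p D g f i ∧ 1 ≤ b0T κ Φ t p D g f i := by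
  rw [b0T_eq]
  have hK : 1 ≤ Neg.Kq κ := by have := (Neg.forty_le_K κ).1; rw [Neg.K_eq] at this; omega
  have hs : 1 ≤ (fcells κ Φ t p D g f).s i := (fcells κ Φ t p D g f).hs i
  refine ⟨by nlinarith, ?_⟩
  calc 1 ≤ 10 * 1 * 1 := by norm_num
    _ ≤ 10 * Neg.Kq κ * (fcells κ Φ t p D g f).s i := Nat.mul_le_mul (Nat.mul_le_mul_left _ hK) hs

/-- `b0T i ≤ 2·r i` and `r i ≤ 4·b0T i + 3` (p5-g9's `hbr` and the lower room `r/4`). [folklore] -/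
theorem b0T_le_two (i : Fin 2) : b0T κ Φ t p D g f i ≤ 2 * (fcells κ Φ t p D g f).r i ∧ (fcells κ Φ t p D g f).r i ≤ 4 * b0T κ Φ t p D g f i + 3 := by
  rw [b0T_eq_div]; omega

variable (O : OutO V) (gv fv : Neg.FSlot) (Sv : SSlot) (q : unitInterval)

/-- **THE SCHEME OF RECORD WITH SMALL ARRIVAL BOXES at `(O, q)`**: `cellGeomSG₂b` over the oriented fine map, the cells `fcells`, root `t`, schedule `schedOf (Sv …)`, boxes `b0`.
[cite: KozmaNitzan2024, §4 pp. 25–27 (Q_v, M_v, E_{v,x}, H^j_{v,x})] -/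
def ΓOT : CellGeom V ℕ :=
  Skelφ.cellGeomSG₂b G (fineO κ Φ t p O.D O.DT O.ori (gOf κ Φ t p O gv) (fOf κ Φ t p O fv))
    (fcells κ Φ t p O.merged (gOf κ Φ t p O gv) (fOf κ Φ t p O fv)) t
    (schedOf κ Φ t p O.merged (gOf κ Φ t p O gv) (fOf κ Φ t p O fv) (Sv κ Φ t p O.merged (gOf κ Φ t p O gv) (fOf κ Φ t p O fv) q))
    (b0T κ Φ t p O.merged (gOf κ Φ t p O gv) (fOf κ Φ t p O fv))

/-- **The face data of record at `(O, q)`** — unchanged (`faceDataSG` does not read `M`): `FDOT = FDO`. [this work] -/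
abbrev FDOT : FaceData V ℕ := FDO κ Φ t p O gv fv Sv q

variable (hC : Φ.CylSubcritical p) (Pv : PSlot)

/-- **THE N1 CHOICES OF RECORD (S1) at `(κ, Φ, t, p)` with the four slots** — `choiceAtOB` with `Γ := ΓOT`. [cite: KozmaNitzan2024, §4 Theorem 6 (pp. 25–31)] -/
def choiceAtOT : ChoiceNO κ Φ t p hC where
  δI := Neg.δI κ Φ
  m₀ := Neg.m₀
  Sz := fun O => Neg.Sz O.merged
  SMn := fun O => SMnP κ Φ t p O.merged (gOf κ Φ t p O gv) (fOf κ Φ t p O fv) Pv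
  Γ := fun O q => ΓOT κ Φ t p O gv fv Sv q
  FD := fun O q => FDO κ Φ t p O gv fv Sv q
  LD := fun O _ => LDO κ Φ t p O gv fv
  δI_pos := Neg.δI_pos κ Φ
  δI_lt_one := Neg.δI_lt_one κ Φ
  S_adm := fun O _ => ⟨Neg.Sz_adm O.merged, SMnP_adm_at κ Φ t p O.merged _ _ Pv⟩

end Values

end NegB

/-- **THE CHOICE FUNCTION OF THE {±1} NODE OF RECORD WITH SMALL ARRIVAL BOXES (S1), four slots** (box `gv`, width `fv`, extra pairs `Pv`, fibre block `Sv`).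
[cite: KozmaNitzan2024, §4 Theorem 6 (pp. 25–31)] -/
def negChoiceAllOT (gv fv : Neg.FSlot) (Pv : NegB.PSlot) (Sv : NegB.SSlot) : ChoiceFnNO :=
  fun κ _ _ _ _ _ Φ _ t _ _ p _ _ hC => NegB.choiceAtOT κ Φ t p gv fv Sv hC Pv

/-- `negChoiceAllOT` unfolds to `NegB.choiceAtOT` (by `rfl`). [folklore] -/
theorem negChoiceAllOT_eq (gv fv : Neg.FSlot) (Pv : NegB.PSlot) (Sv : NegB.SSlot) (κ : Consts) {V : Type} [DecidableEq V] [Countable V] (G : SimpleGraph V)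
    [G.LocallyFinite] (Φ : PlanarSkeletonNeg G) (hg : ¬ HasExponentialGrowth G) (t : V) (ht : t ∈ Φ.types) (h1 : Φ.types = {t}) (p : unitInterval)
    (hp0 : 0 < (p : ℝ)) (hp1 : (p : ℝ) < 1) (hC : Φ.CylSubcritical p) :
    negChoiceAllOT gv fv Pv Sv κ G Φ hg t ht h1 p hp0 hp1 hC = NegB.choiceAtOT κ Φ t p gv fv Sv hC Pv := rfl

/-! ## §2 Unpacking `AtQO` for the S1 choices (proofs verbatim those of SkelNegBChoiceAll §2: `AtQO` reads only `δI, m₀, Sz, SMn`, which agree) -/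

namespace NegB

open Neg

section AtQ

variable {κ : Consts} {V : Type} [DecidableEq V] [Countable V] {G : SimpleGraph V} [G.LocallyFinite] {Φ : PlanarSkeletonNeg G} {t : V} {p : unitInterval}
  {hC : Φ.CylSubcritical p} {gv fv : Neg.FSlot} {Pv : PSlot} {Sv : SSlot} {O : OutO V} {q : unitInterval}

/-- `FactsO`, the density window and Φ2 at `q` out of `AtQO`. [folklore] -/
theorem factsO_of_atQOT (hAt : (choiceAtOT κ Φ t p gv fv Sv hC Pv).AtQO O q) :
    O.FactsO Φ.frame hC Neg.m₀ t ∧ (p : ℝ) / 2 ≤ q ∧ (q : ℝ) ≤ p ∧ Φ.CylSubcritical q := ⟨hAt.1, hAt.2.1, hAt.2.2.1, hAt.2.2.2.2⟩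

/-- **`AtQO` of the S1 choices gives `AtQO` of the fat-box choices** (same `δI, m₀, Sz, SMn`) — so EVERY `…_of_atQOB` lemma (SkelNegBChoiceAll §2, SkelNegBParamsSlotsR §3) applies
after `atQOB_of_atQOT hAt`. (Stated componentwise, not by `Iff.rfl`: the kernel must never compare the two schemes.) [folklore] -/
theorem atQOB_of_atQOT (hAt : (choiceAtOT κ Φ t p gv fv Sv hC Pv).AtQO O q) : (choiceAtOB κ Φ t p Pv gv fv Sv hC).AtQO O q := by
  obtain ⟨h1, h2, h3, h4, h5⟩ := hAt
  have h1' : O.FactsO Φ.frame hC Neg.m₀ t := h1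
  have h4' : ∀ i ∈ Skelφ.StepI.indexNP {t} (Neg.Sz O.merged) (SMnP κ Φ t p O.merged (gOf κ Φ t p O gv) (fOf κ Φ t p O fv) Pv),
      1 - Neg.δI κ Φ < (bondPercolation G q).real (Skelφ.StepI.eventO G Φ.φ O.D O.DT O.ori i) := h4
  exact ⟨h1', h2, h3, h4', h5⟩

/-- The converse transfer. [folklore] -/
theorem atQOT_of_atQOB (hAt : (choiceAtOB κ Φ t p Pv gv fv Sv hC).AtQO O q) : (choiceAtOT κ Φ t p gv fv Sv hC Pv).AtQO O q := by
  obtain ⟨h1, h2, h3, h4, h5⟩ := hAt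
  have h1' : O.FactsO Φ.frame hC Neg.m₀ t := h1
  have h4' : ∀ i ∈ Skelφ.StepI.indexNP {t} (Neg.Sz O.merged) (SMnP κ Φ t p O.merged (gOf κ Φ t p O gv) (fOf κ Φ t p O fv) Pv),
      1 - Neg.δI κ Φ < (bondPercolation G q).real (Skelφ.StepI.eventO G Φ.φ O.D O.DT O.ori i) := h4
  exact ⟨h1', h2, h3, h4', h5⟩

/-- **`AtQO` of the T choices gives `AtQO` of the S1 (`b0 = r/8`) choices** — so every landed `…_of_atQOS` / `KS.…_R` / `KS.…_of_atQOS` lemma applies after it. [folklore] -/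
theorem atQOS_of_atQOT (hAt : (choiceAtOT κ Φ t p gv fv Sv hC Pv).AtQO O q) : (choiceAtOS κ Φ t p gv fv Sv hC Pv).AtQO O q :=
  atQOS_of_atQOB (atQOB_of_atQOT hAt)

/-- The numeric long clause at the merged record out of `AtQO`. [folklore] -/
theorem eqNumL_of_atQOT (hAt : (choiceAtOT κ Φ t p gv fv Sv hC Pv).AtQO O q) : EqNumL κ Φ t p O.merged (gOf κ Φ t p O gv) (fOf κ Φ t p O fv) :=
  eqNumL_of_atQOB (atQOB_of_atQOT hAt)

/-- The long clause (oriented map `φL`, `|h_L| ≤ 10 n_L`) out of `AtQO`. [folklore] -/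
theorem clauseL_of_atQOT (hAt : (choiceAtOT κ Φ t p gv fv Sv hC Pv).AtQO O q) :
    O.merged.EqGeom G (φL κ Φ t p O.D O.DT O.ori (gOf κ Φ t p O gv) (fOf κ Φ t p O fv)) t (ML κ Φ t p O.merged (gOf κ Φ t p O gv))
        (nL κ Φ t p O.merged (gOf κ Φ t p O gv) (fOf κ Φ t p O fv)) ∧
      (hL κ Φ t p O.merged (gOf κ Φ t p O gv) (fOf κ Φ t p O fv)).natAbs ≤ 10 * nL κ Φ t p O.merged (gOf κ Φ t p O gv) (fOf κ Φ t p O fv) :=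
  clauseL_of_atQOB (atQOB_of_atQOT hAt)

/-- The short clause out of `AtQO`. [folklore] -/
theorem clauseS_of_atQOT (hAt : (choiceAtOT κ Φ t p gv fv Sv hC Pv).AtQO O q) :
    O.merged.EqGeom G (φS t O.D O.DT O.ori (Φ := Φ)) t (Mu O.merged) (nS O.merged) ∧ (hS t O.merged).natAbs ≤ 10 * nS O.merged :=
  clauseS_of_atQOB (atQOB_of_atQOT hAt)

/-- The clause of ANY admissible pair out of `AtQO`. [folklore] -/
theorem clauseP_of_atQOT (hAt : (choiceAtOT κ Φ t p gv fv Sv hC Pv).AtQO O q) {M n : ℕ} (hM : O.D.M₀ ≤ M) (hn : O.D.n₁ M ≤ n) :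
    O.merged.EqGeom G (oriφ Φ.φ (O.ori t M n)) t M n ∧ (O.merged.hgt t M n).natAbs ≤ 10 * n :=
  clauseP_of_atQOB (atQOB_of_atQOT hAt) hM hn

/-- The piece-links of any listed pair at `q`. [folklore] -/
theorem inputsP_of_atQOT (hAt : (choiceAtOT κ Φ t p gv fv Sv hC Pv).AtQO O q) {M n : ℕ}
    (hMn : (M, n) ∈ SMnP κ Φ t p O.merged (gOf κ Φ t p O gv) (fOf κ Φ t p O fv) Pv) (fam : Fin 2) (σ τ : ℤˣ) :
    1 - Neg.δI κ Φ < (bondPercolation G q).real (Skelφ.StepI.eventN G (oriφ Φ.φ (O.ori t M n)) O.merged (t, M, some (n, fam, σ, τ))) :=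
  inputsP_of_atQOB (atQOB_of_atQOT hAt) hMn fam σ τ

/-- The extra pairs' piece-links. [folklore] -/
theorem inputsExtra_of_atQOT (hAt : (choiceAtOT κ Φ t p gv fv Sv hC Pv).AtQO O q) {M n : ℕ} (hMn : (M, n) ∈ (Pv κ Φ t p O.merged).1) (fam : Fin 2)
    (σ τ : ℤˣ) :
    1 - Neg.δI κ Φ < (bondPercolation G q).real (Skelφ.StepI.eventN G (oriφ Φ.φ (O.ori t M n)) O.merged (t, M, some (n, fam, σ, τ))) :=
  inputsExtra_of_atQOB (atQOB_of_atQOT hAt) hMn fam σ τ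

/-- The short pair's piece-links. [folklore] -/
theorem inputsS_of_atQOT (hAt : (choiceAtOT κ Φ t p gv fv Sv hC Pv).AtQO O q) (fam : Fin 2) (σ τ : ℤˣ) :
    1 - Neg.δI κ Φ <
      (bondPercolation G q).real (Skelφ.StepI.eventN G (φS t O.D O.DT O.ori (Φ := Φ)) O.merged (t, Mu O.merged, some (nS O.merged, fam, σ, τ))) :=
  inputsS_of_atQOB (atQOB_of_atQOT hAt) fam σ τ

/-- The long pair's piece-links. [folklore] -/
theorem inputsL_of_atQOT (hAt : (choiceAtOT κ Φ t p gv fv Sv hC Pv).AtQO O q) (fam : Fin 2) (σ τ : ℤˣ) :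
    1 - Neg.δI κ Φ <
      (bondPercolation G q).real (Skelφ.StepI.eventN G (φL κ Φ t p O.D O.DT O.ori (gOf κ Φ t p O gv) (fOf κ Φ t p O fv)) O.merged
        (t, ML κ Φ t p O.merged (gOf κ Φ t p O gv), some (nL κ Φ t p O.merged (gOf κ Φ t p O gv) (fOf κ Φ t p O fv), fam, σ, τ))) :=
  inputsL_of_atQOB (atQOB_of_atQOT hAt) fam σ τ

/-- The uniqueness zone at `M_u`. [folklore] -/
theorem zone_of_atQOT (hAt : (choiceAtOT κ Φ t p gv fv Sv hC Pv).AtQO O q) :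
    1 - Neg.δI κ Φ < (bondPercolation G q).real (Skelφ.StepI.eventN G (φS t O.D O.DT O.ori (Φ := Φ)) O.merged (t, Mu O.merged, none)) :=
  zone_of_atQOB (atQOB_of_atQOT hAt)

end AtQ

end NegB

/-! ## §3 The geometric obligation of the S1 choices of record -/

/-- **`GeomHoldsNOFn (negChoiceAllOT gv fv Pv Sv)` FOR EVERY SLOT VALUE** (the `r/4` scheme of record; `b0T ≤ 3r` by `b0T_le`). [cite: KozmaNitzan2024, §4 pp. 25–29] -/
theorem geomHoldsNOFn_negChoiceAllOT (gv fv : Neg.FSlot) (Pv : NegB.PSlot) (Sv : NegB.SSlot) : GeomHoldsNOFn (negChoiceAllOT gv fv Pv Sv) := by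
  intro κ V _ _ G _ Φ hg t ht h1 p hp0 hp1 hC O q hAt
  obtain ⟨-, -, hR, -, -⟩ := hAt.1.shared
  obtain ⟨h1', h2, -, h4, h5, h6, h7, h8, h9⟩ := NegB.geom_fine_at_b κ Φ t p O.merged (NegB.gOf κ Φ t p O gv) (NegB.fOf κ Φ t p O fv)
    (NegB.lip_φL κ Φ t p O.D O.DT O.ori (NegB.gOf κ Φ t p O gv) (NegB.fOf κ Φ t p O fv))
    (NegB.steps_φL κ Φ t p O.D O.DT O.ori (NegB.gOf κ Φ t p O gv) (NegB.fOf κ Φ t p O fv))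
    (NegB.eqNumL_of_factsO κ Φ t p O.D O.DT O.ori _ _ hR hAt.1.clauses)
    (NegB.schedOf_WFS2 κ Φ t p O.merged (NegB.gOf κ Φ t p O gv) (NegB.fOf κ Φ t p O fv)
      (Sv κ Φ t p O.merged (NegB.gOf κ Φ t p O gv) (NegB.fOf κ Φ t p O fv) q))
    (NegB.colQ_schedOf κ Φ t p O.merged (NegB.gOf κ Φ t p O gv) (NegB.fOf κ Φ t p O fv)
      (Sv κ Φ t p O.merged (NegB.gOf κ Φ t p O gv) (NegB.fOf κ Φ t p O fv) q))
    (NegB.b0T_le κ Φ t p O.merged (NegB.gOf κ Φ t p O gv) (NegB.fOf κ Φ t p O fv))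
  exact ⟨h1', h2, h4, h5, h6, h7, h8, h9⟩

end PlanarSkeletonNeg

end Summit.CriticalPhenomena.PercolationContinuityZ3.Theorems.Transplant

end
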